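import Summits.AnomalousDissipation.AnomalousDissipation.Theorems.EnsembleRigidityGPMeanBoundedFamilyStubHeadCoefficients
import Summits.AnomalousDissipation.AnomalousDissipation.Theorems.LightSteadyStatesGP.Negative.TrivialWitnesses
import Literature.Analysis.FluidPDE.AlexakisDoeringProofs
import Literature.Analysis.FluidPDE.LerayHopfTimeSliceTorus
import Literature.Analysis.FunctionSpaces.TorusFluidGlueProofs
import Literature.Analysis.FunctionSpaces.TorusFourierModes
import Literature.Analysis.FunctionSpaces.TorusTrigPoly

/-!
# Stub `stub_antiLaminarGP` (S6) of line `Sketch` (crux stmt-AnomalousDissipation-15151,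
  `VirtualDissipation.LightSteadyStatesGP`)

The ANTI-LAMINAR LAW for the `G`-symmetric mean-zero classical steady states `(u, p)` of
`NS_ν(f_GP)` (`f_GP = gpForce`, the Galloway–Proctor force; `g = lambMode`, its Lamb mode), GIVEN
verbatim the pinning of the forcing shell (stub S3: `P₁u = (2/3)(f_GP, u)·f_GP`,
`P₁ = Torus.fourierTruncate 1`) and the Lamb-mode test (stub S5: `b(u, g, u) = 8π²ν (u, g)` for
every classical steady state): there is ONE constant `C > 0` with

  `∫‖P₁u‖² ≤ C·((∫‖u‖² − ∫‖P₁u‖²) + ν²)`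

for all of them — the forcing-shell energy is slaved to the tail energy.

Proof (soft constants, existence only). Write `β = (2/3)(f_GP, u)` and `w = u − β f_GP`.
* Pinning gives `P₁u = β f_GP`, so `∫‖P₁u‖² = (3/2)β²` (`∫‖f_GP‖² = 3/2`), and `(f_GP, w) = 0`, whence
  `∫‖u‖² = (3/2)β² + ∫‖w‖²` (`StubAntiLaminar.integral_norm_sq_decomp`): the tail energy is `∫‖w‖²`.
* Bilinearity of `b(·, g, ·)` in the transporting and tested fields
  (`StubAntiLaminar.integral_inner_convect_decomp`) and `(f_GP, g) = 0` turn S5 into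
  `(3π/2)β² = β·(b(f,g,w) + b(w,g,f)) + b(w,g,w) − 8π²ν (w, g)`, the definite coefficient being
  `b(f,g,f) = −b(f,f,g) = −2π·(3/4)` (antisymmetry `Torus.integral_inner_convect_eq_neg` and the landed
  head integral, `StubAntiLaminar.integral_inner_convect_gpForce_lambMode_gpForce`).
* Sup bounds of the smooth fields `(f·∇)g`, `f`, `g`, `∂ᵢg` on the compact torus and Cauchy–Schwarz
  `∫‖w‖ ≤ (∫‖w‖²)^{1/2}` bound the three `w`-terms by `K₁√E'`, `K₂E'`, `K₄√E'`, `E' = ∫‖w‖²`, with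
  constants fixed before `(ν, u, p)` (`StubAntiLaminar.exists_bounds`); AM–GM closes
  (`StubAntiLaminar.key_ineq`).
-/

noncomputable section

-- every `Summit.AnomalousDissipation.AnomalousDissipation.…` name repeats the summit = sub-problem segment (D-0017 layout)
set_option linter.dupNamespace false

namespace Summit.AnomalousDissipation.AnomalousDissipation.Theorems.VirtualDissipation.LightSteadyStatesGP

open MeasureTheory Filter Topology UnitAddTorus
open scoped InnerProductSpace ENNReal
open Literature.Analysis.FunctionSpaces Literature.Analysis.FluidPDE
open Summit.AnomalousDissipation.AnomalousDissipation.Theorems.EnsembleRigidity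

namespace StubAntiLaminar

/-! ## The two head modes: regularity and the definite head coefficient -/

/-- `f_GP` is smooth and solenoidal (landed `stub_gpAdmissible`; `gpForce` is that inline force by
`rfl`). [folklore] -/
theorem gpForce_smooth_divFree : Torus.IsSmooth gpForce ∧ Torus.IsDivFree gpForce :=
  ⟨SteadyStatesLoudBounded.GpAdmissible.stub_gpAdmissible.1,
    SteadyStatesLoudBounded.GpAdmissible.stub_gpAdmissible.2.1⟩

/-- The Lamb mode `g` is smooth (landed `stub_headModes`). [folklore] -/
theorem lambMode_smooth : Torus.IsSmooth lambMode :=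
  GPMeanBoundedFamily.stub_headModes.1.1

/-- The definite head coefficient `b(f_GP, g, f_GP) = ∫⟪(f_GP·∇)g, f_GP⟫ = −2π·(3/4) = −3π/2`:
antisymmetry `b(f, g, f) = −b(f, f, g)` (`Torus.integral_inner_convect_eq_neg`, `f_GP` solenoidal;
Temam 1984, Ch. II §1.2, Lemma 1.3) and the landed head integral `∫⟪(f_GP·∇)f_GP, g⟫ = 2π·(3/4)`.
[folklore] -/
theorem integral_inner_convect_gpForce_lambMode_gpForce :
    ∫ x : UnitAddTorus (Fin 3), ⟪Torus.convect gpForce lambMode x, gpForce x⟫_ℝ =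
      -(2 * Real.pi * (3 / 4)) := by
  obtain ⟨hfs, hfd⟩ := gpForce_smooth_divFree
  rw [Torus.integral_inner_convect_eq_neg hfs hfd lambMode_smooth hfs,
    ← GPMeanBoundedFamily.stub_headCoefficients.1]
  congr 1
  exact integral_congr_ae (ae_of_all _ fun x => real_inner_comm _ _)

/-! ## Expansion of the Lamb-mode test and of the energy along `u = β f_GP + w` -/

/-- Pointwise linearity in the transporting field: `((βf + w)·∇)g = β (f·∇)g + (w·∇)g`
(`(u·∇)g (x) = Dg(x)[u x]` and `Dg(x)` is linear; no derivative of `u` is involved). [folklore] -/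
theorem convect_decomp {β : ℝ} {u w : UnitAddTorus (Fin 3) → EuclideanSpace ℝ (Fin 3)}
    (hu : ∀ x, u x = β • gpForce x + w x) (x : UnitAddTorus (Fin 3)) :
    Torus.convect u lambMode x =
      β • Torus.convect gpForce lambMode x + Torus.convect w lambMode x := by
  simp only [Torus.convect]
  rw [hu x, map_add, map_smul]

/-- The Lamb-mode test form expanded along `u = β f_GP + w`:
`b(u, g, u) = β² b(f, g, f) + β (b(f, g, w) + b(w, g, f)) + b(w, g, w)`. [folklore] -/
theorem integral_inner_convect_decomp {β : ℝ}
    {u w : UnitAddTorus (Fin 3) → EuclideanSpace ℝ (Fin 3)} (hw : Torus.IsSmooth w)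
    (hu : ∀ x, u x = β • gpForce x + w x) :
    ∫ x, ⟪Torus.convect u lambMode x, u x⟫_ℝ =
      β ^ 2 * (∫ x, ⟪Torus.convect gpForce lambMode x, gpForce x⟫_ℝ) +
        β * ((∫ x, ⟪Torus.convect gpForce lambMode x, w x⟫_ℝ) +
          ∫ x, ⟪Torus.convect w lambMode x, gpForce x⟫_ℝ) +
        ∫ x, ⟪Torus.convect w lambMode x, w x⟫_ℝ := by
  have hfs := gpForce_smooth_divFree.1
  have hgs := lambMode_smooth
  have hpt : ∀ x, ⟪Torus.convect u lambMode x, u x⟫_ℝ =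
      β ^ 2 * ⟪Torus.convect gpForce lambMode x, gpForce x⟫_ℝ +
        β * (⟪Torus.convect gpForce lambMode x, w x⟫_ℝ +
          ⟪Torus.convect w lambMode x, gpForce x⟫_ℝ) +
        ⟪Torus.convect w lambMode x, w x⟫_ℝ := fun x => by
    rw [convect_decomp hu x, hu x]
    simp only [inner_add_left, inner_add_right, real_inner_smul_left, real_inner_smul_right]
    ring
  simp_rw [hpt]
  have i1 : Integrable (fun x => ⟪Torus.convect gpForce lambMode x, gpForce x⟫_ℝ) volume :=
    ((hfs.convect hgs).inner hfs).integrable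
  have i2 : Integrable (fun x => ⟪Torus.convect gpForce lambMode x, w x⟫_ℝ) volume :=
    ((hfs.convect hgs).inner hw).integrable
  have i3 : Integrable (fun x => ⟪Torus.convect w lambMode x, gpForce x⟫_ℝ) volume :=
    ((hw.convect hgs).inner hfs).integrable
  have i4 : Integrable (fun x => ⟪Torus.convect w lambMode x, w x⟫_ℝ) volume :=
    ((hw.convect hgs).inner hw).integrable
  have i23 : Integrable (fun x => ⟪Torus.convect gpForce lambMode x, w x⟫_ℝ +
      ⟪Torus.convect w lambMode x, gpForce x⟫_ℝ) volume := i2.add i3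
  have i1' : Integrable (fun x => β ^ 2 * ⟪Torus.convect gpForce lambMode x, gpForce x⟫_ℝ) volume :=
    i1.const_mul _
  have i23' : Integrable (fun x => β * (⟪Torus.convect gpForce lambMode x, w x⟫_ℝ +
      ⟪Torus.convect w lambMode x, gpForce x⟫_ℝ)) volume := i23.const_mul β
  have i123 : Integrable (fun x => β ^ 2 * ⟪Torus.convect gpForce lambMode x, gpForce x⟫_ℝ +
      β * (⟪Torus.convect gpForce lambMode x, w x⟫_ℝ +
        ⟪Torus.convect w lambMode x, gpForce x⟫_ℝ)) volume := i1'.add i23'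
  rw [integral_add i123 i4, integral_add i1' i23', integral_const_mul, integral_const_mul,
    integral_add i2 i3]

/-- The pairing with the Lamb mode along `u = β f_GP + w`: `(u, g) = (w, g)`, since `(f_GP, g) = 0`
(landed `Negative.TrivialWitnesses.integral_inner_gpForce_lambMode`: first shell against second
shell). [folklore] -/
theorem integral_inner_lambMode_decomp {β : ℝ}
    {u w : UnitAddTorus (Fin 3) → EuclideanSpace ℝ (Fin 3)} (hw : Torus.IsSmooth w)
    (hu : ∀ x, u x = β • gpForce x + w x) :
    ∫ x, ⟪u x, lambMode x⟫_ℝ = ∫ x, ⟪w x, lambMode x⟫_ℝ := by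
  have hfs := gpForce_smooth_divFree.1
  have hgs := lambMode_smooth
  have hpt : ∀ x, ⟪u x, lambMode x⟫_ℝ =
      β * ⟪gpForce x, lambMode x⟫_ℝ + ⟪w x, lambMode x⟫_ℝ := fun x => by
    rw [hu x, inner_add_left, real_inner_smul_left]
  simp_rw [hpt]
  rw [integral_add ((hfs.inner hgs).integrable.const_mul β) (hw.inner hgs).integrable,
    integral_const_mul,
    Summit.AnomalousDissipation.AnomalousDissipation.Theorems.LightSteadyStatesGP.Negative.TrivialWitnesses.integral_inner_gpForce_lambMode,
    mul_zero, zero_add]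

/-- Energy splitting along `u = β f_GP + w` with `(f_GP, w) = 0` (Pythagoras):
`∫‖u‖² = (3/2)β² + ∫‖w‖²`, as `∫‖f_GP‖² = 3/2`. [folklore] -/
theorem integral_norm_sq_decomp {β : ℝ}
    {u w : UnitAddTorus (Fin 3) → EuclideanSpace ℝ (Fin 3)} (hw : Torus.IsSmooth w)
    (hu : ∀ x, u x = β • gpForce x + w x) (horth : ∫ x, ⟪gpForce x, w x⟫_ℝ = 0) :
    ∫ x, ‖u x‖ ^ 2 = 3 / 2 * β ^ 2 + ∫ x, ‖w x‖ ^ 2 := by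
  have hfs := gpForce_smooth_divFree.1
  have hpt : ∀ x, ‖u x‖ ^ 2 =
      β ^ 2 * ‖gpForce x‖ ^ 2 + 2 * β * ⟪gpForce x, w x⟫_ℝ + ‖w x‖ ^ 2 := fun x => by
    rw [hu x, norm_add_sq_real, norm_smul, mul_pow, Real.norm_eq_abs, sq_abs,
      real_inner_smul_left]
    ring
  simp_rw [hpt]
  have i1 : Integrable (fun x => β ^ 2 * ‖gpForce x‖ ^ 2) volume :=
    hfs.norm_sq.integrable.const_mul _
  have i2 : Integrable (fun x => 2 * β * ⟪gpForce x, w x⟫_ℝ) volume :=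
    (hfs.inner hw).integrable.const_mul _
  have i12 : Integrable (fun x => β ^ 2 * ‖gpForce x‖ ^ 2 + 2 * β * ⟪gpForce x, w x⟫_ℝ) volume :=
    i1.add i2
  rw [integral_add i12 hw.norm_sq.integrable, integral_add i1 i2, integral_const_mul,
    integral_const_mul, horth, GPMeanBoundedFamily.StubHeadCoefficients.integral_norm_sq_gpForce]
  ring

/-! ## Soft bounds of the `w`-terms and the closing real inequality -/

/-- Soft bounds of the three `w`-dependent terms of the expanded Lamb-mode test, with constants fixed
BEFORE `w`: sup bounds of the continuous fields `(f_GP·∇)g`, `f_GP`, `g` and of `∑ᵢ‖∂ᵢg‖` on the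
compact torus, `‖(w·∇)g‖ ≤ ‖w‖ ∑ᵢ‖∂ᵢg‖`, and Cauchy–Schwarz `∫‖w‖ ≤ (∫‖w‖²)^{1/2}` on the
probability space `T³` give `|b(f,g,w) + b(w,g,f)| ≤ K₁ (∫‖w‖²)^{1/2}`, `|b(w,g,w)| ≤ K₂ ∫‖w‖²`,
`|(w,g)| ≤ K₄ (∫‖w‖²)^{1/2}` for every smooth `w`. [folklore] -/
theorem exists_bounds :
    ∃ K₁ K₂ K₄ : ℝ, 0 ≤ K₁ ∧ 0 ≤ K₂ ∧ 0 ≤ K₄ ∧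
      ∀ w : UnitAddTorus (Fin 3) → EuclideanSpace ℝ (Fin 3), Torus.IsSmooth w →
        |(∫ x, ⟪Torus.convect gpForce lambMode x, w x⟫_ℝ) +
            ∫ x, ⟪Torus.convect w lambMode x, gpForce x⟫_ℝ| ≤
          K₁ * Real.sqrt (∫ x, ‖w x‖ ^ 2) ∧
        |∫ x, ⟪Torus.convect w lambMode x, w x⟫_ℝ| ≤ K₂ * ∫ x, ‖w x‖ ^ 2 ∧
        |∫ x, ⟪w x, lambMode x⟫_ℝ| ≤ K₄ * Real.sqrt (∫ x, ‖w x‖ ^ 2) := by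
  have hfs := gpForce_smooth_divFree.1
  have hgs := lambMode_smooth
  obtain ⟨Ka, hKa0, hKa⟩ :=
    Torus.exists_nonneg_forall_norm_le_of_continuous (hfs.convect hgs).continuous
  obtain ⟨Mf, hMf0, hMf⟩ := Torus.exists_nonneg_forall_norm_le_of_continuous hfs.continuous
  obtain ⟨Mg, hMg0, hMg⟩ := Torus.exists_nonneg_forall_norm_le_of_continuous hgs.continuous
  obtain ⟨Sg, hSg0, hSg⟩ := Torus.exists_sum_norm_partialDeriv_le hgs
  refine ⟨Ka + Mf * Sg, Sg, Mg, by positivity, hSg0, hMg0, fun w hw => ?_⟩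
  have hw2 : MemLp w 2 volume := hw.memLp 2
  have hJ : ∫ x, ‖w x‖ ≤ Real.sqrt (∫ x, ‖w x‖ ^ 2) := integral_norm_le_sqrt_integral_norm_sq hw2
  refine ⟨?_, ?_, ?_⟩
  · -- `|b(f,g,w)| ≤ Ka √E'` and `|b(w,g,f)| ≤ Mf ∫‖(w·∇)g‖ ≤ Mf Sg ∫‖w‖ ≤ Mf Sg √E'`
    have h1 : |∫ x, ⟪Torus.convect gpForce lambMode x, w x⟫_ℝ| ≤
        Ka * Real.sqrt (∫ x, ‖w x‖ ^ 2) :=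
      abs_integral_inner_le_mul_sqrt hw2 hKa0 hKa
    have h2 : |∫ x, ⟪Torus.convect w lambMode x, gpForce x⟫_ℝ| ≤
        Mf * ∫ x, ‖Torus.convect w lambMode x‖ :=
      Torus.abs_integral_inner_le_of_norm_le (hw.convect hgs).integrable hMf
    have h3 : ∫ x, ‖Torus.convect w lambMode x‖ ≤ Sg * ∫ x, ‖w x‖ := by
      rw [← integral_const_mul]
      refine integral_mono (hw.convect hgs).integrable.norm (hw.integrable.norm.const_mul Sg)
        fun x => ?_
      calc ‖Torus.convect w lambMode x‖
          ≤ ‖w x‖ * ∑ i, ‖Torus.partialDeriv i lambMode x‖ :=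
            Literature.Analysis.FunctionSpaces.Torus.norm_convect_le w (hgs.isContDiff (by simp)) x
        _ ≤ ‖w x‖ * Sg := mul_le_mul_of_nonneg_left (hSg x) (norm_nonneg _)
        _ = Sg * ‖w x‖ := mul_comm _ _
    calc |(∫ x, ⟪Torus.convect gpForce lambMode x, w x⟫_ℝ) +
            ∫ x, ⟪Torus.convect w lambMode x, gpForce x⟫_ℝ|
        ≤ |∫ x, ⟪Torus.convect gpForce lambMode x, w x⟫_ℝ| +
            |∫ x, ⟪Torus.convect w lambMode x, gpForce x⟫_ℝ| := abs_add_le _ _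
      _ ≤ Ka * Real.sqrt (∫ x, ‖w x‖ ^ 2) + Mf * (Sg * Real.sqrt (∫ x, ‖w x‖ ^ 2)) :=
          add_le_add h1 (h2.trans (mul_le_mul_of_nonneg_left
            (h3.trans (mul_le_mul_of_nonneg_left hJ hSg0)) hMf0))
      _ = (Ka + Mf * Sg) * Real.sqrt (∫ x, ‖w x‖ ^ 2) := by ring
  · -- `|b(w,g,w)| ≤ Sg ∫‖w‖²`
    rw [integral_congr_ae (ae_of_all _ fun x => real_inner_comm (w x) (Torus.convect w lambMode x))]
    exact Torus.abs_integral_inner_convect_self_le hw2 hgs hSg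
  · -- `|(w,g)| ≤ Mg ∫‖w‖ ≤ Mg √E'`
    calc |∫ x, ⟪w x, lambMode x⟫_ℝ| ≤ Mg * ∫ x, ‖w x‖ :=
          Torus.abs_integral_inner_le_of_norm_le hw.integrable hMg
      _ ≤ Mg * Real.sqrt (∫ x, ‖w x‖ ^ 2) := mul_le_mul_of_nonneg_left hJ hMg0

/-- The closing real inequality (AM–GM twice): if `A β² = β L + Q − M ν P` with `A > 0`, `M ≥ 0`,
`K₂ ≥ 0`, `|L| ≤ K₁ s`, `|Q| ≤ K₂ s²`, `|P| ≤ K₄ s`, then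
`(3/2) β² ≤ (3/(2A²))·(K₁² + A(2K₂ + 1 + M²K₄²))·(s² + ν²)`
(`A|β|K₁s ≤ ½(A²β² + K₁²s²)`, `A·M|ν|K₄s ≤ ½A(s² + M²K₄²ν²)`). [folklore] -/
theorem key_ineq {A M K₁ K₂ K₄ β L Q P ν s : ℝ} (hA : 0 < A) (hM : 0 ≤ M) (hK₂ : 0 ≤ K₂)
    (hL : |L| ≤ K₁ * s) (hQ : |Q| ≤ K₂ * s ^ 2) (hP : |P| ≤ K₄ * s)
    (hid : A * β ^ 2 = β * L + Q - M * ν * P) :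
    3 / 2 * β ^ 2 ≤
      3 / (2 * A ^ 2) * (K₁ ^ 2 + A * (2 * K₂ + 1 + M ^ 2 * K₄ ^ 2)) * (s ^ 2 + ν ^ 2) := by
  -- `A β² ≤ |β| K₁ s + K₂ s² + M |ν| K₄ s`
  have h1 : β * L ≤ |β| * (K₁ * s) :=
    (le_abs_self _).trans (by rw [abs_mul]; exact mul_le_mul_of_nonneg_left hL (abs_nonneg β))
  have h2 : Q ≤ K₂ * s ^ 2 := (le_abs_self Q).trans hQ
  have h3 : -(M * ν * P) ≤ M * |ν| * (K₄ * s) := by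
    calc -(M * ν * P) ≤ |M * ν * P| := neg_le_abs _
      _ = M * |ν| * |P| := by rw [abs_mul, abs_mul, abs_of_nonneg hM]
      _ ≤ M * |ν| * (K₄ * s) := mul_le_mul_of_nonneg_left hP (by positivity)
  have hmain : A * β ^ 2 ≤ |β| * (K₁ * s) + K₂ * s ^ 2 + M * |ν| * (K₄ * s) := by linarith
  -- AM–GM
  have e1 : 2 * (A * |β|) * (K₁ * s) ≤ (A * |β|) ^ 2 + (K₁ * s) ^ 2 := two_mul_le_add_sq _ _
  have e2 : 2 * s * (M * |ν| * K₄) ≤ s ^ 2 + (M * |ν| * K₄) ^ 2 := two_mul_le_add_sq _ _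
  have e3 : A * (A * β ^ 2) ≤ A * (|β| * (K₁ * s) + K₂ * s ^ 2 + M * |ν| * (K₄ * s)) :=
    mul_le_mul_of_nonneg_left hmain hA.le
  have e4 : A * (2 * s * (M * |ν| * K₄)) ≤ A * (s ^ 2 + (M * |ν| * K₄) ^ 2) :=
    mul_le_mul_of_nonneg_left e2 hA.le
  have hb : (A * |β|) ^ 2 = A ^ 2 * β ^ 2 := by rw [mul_pow, sq_abs]
  have hn : A * (M * |ν| * K₄) ^ 2 = A * M ^ 2 * K₄ ^ 2 * ν ^ 2 := by
    rw [mul_pow, mul_pow, sq_abs]; ring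
  have hx1 : 0 ≤ A * M ^ 2 * K₄ ^ 2 * s ^ 2 := by positivity
  have hx2 : 0 ≤ (K₁ ^ 2 + 2 * A * K₂ + A) * ν ^ 2 := by positivity
  -- `A² β² ≤ (K₁² + 2AK₂ + A) s² + A M² K₄² ν²`
  have e5 : A ^ 2 * β ^ 2 ≤
      (K₁ ^ 2 + A * (2 * K₂ + 1 + M ^ 2 * K₄ ^ 2)) * (s ^ 2 + ν ^ 2) := by
    linarith [e1, e3, e4, hb, hn, hx1, hx2]
  have hA2 : (2 * A ^ 2) ≠ 0 := by positivity
  calc 3 / 2 * β ^ 2 = 3 / (2 * A ^ 2) * (A ^ 2 * β ^ 2) := by field_simp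
    _ ≤ 3 / (2 * A ^ 2) * ((K₁ ^ 2 + A * (2 * K₂ + 1 + M ^ 2 * K₄ ^ 2)) * (s ^ 2 + ν ^ 2)) :=
        mul_le_mul_of_nonneg_left e5 (by positivity)
    _ = _ := by ring

end StubAntiLaminar

open StubAntiLaminar in
/-- **S6 `stub_antiLaminarGP`** — the ANTI-LAMINAR LAW, given pinning (S3) and the Lamb-mode test
(S5) verbatim: there is `C > 0` such that every `G`-symmetric mean-zero classical steady state `(u, p)`
of `NS_ν(f_GP)` satisfies `∫|P₁u|² ≤ C·((∫|u|² − ∫|P₁u|²) + ν²)` — the forcing-shell energy is slaved to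
the tail. Why: write `u = βf_GP + w` with `β = (2/3)(f_GP,u)` (S3: `P₁u = βf_GP`, `(f_GP, w) = 0`,
`∫|u|² = (3/2)β² + ∫|w|²`); expand S5: `(3π/2)β² = β·(b(f,g,w) + b(w,g,f)) + b(w,g,w) − 8π²ν(w, g)`
with `b(f_GP, g, f_GP) = −3π/2` (landed head integrals); sup bounds of `g`, `∇g`, `f_GP`, `(f_GP·∇)g`,
Cauchy–Schwarz and AM-GM. [folklore] -/
theorem stub_antiLaminarGP :
    (∀ u : UnitAddTorus (Fin 3) → EuclideanSpace ℝ (Fin 3), Torus.IsSmooth u → Torus.IsDivFree u →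
      Torus.HasZeroMean u → IsGPSymmetric u →
      Torus.fourierTruncate 1 u = ((2 : ℝ) / 3 * ∫ x, ⟪gpForce x, u x⟫_ℝ) • gpForce) →
    (∀ (ν : ℝ) (u : UnitAddTorus (Fin 3) → EuclideanSpace ℝ (Fin 3)) (p : UnitAddTorus (Fin 3) → ℝ),
      Torus.IsClassicalNSSolutionOn Set.univ ν (fun _ => gpForce) (fun _ => u) (fun _ => p) →
      ∫ x, ⟪Torus.convect u lambMode x, u x⟫_ℝ = 8 * Real.pi ^ 2 * ν * ∫ x, ⟪u x, lambMode x⟫_ℝ) →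
    ∃ C : ℝ, 0 < C ∧
      ∀ (ν : ℝ) (u : UnitAddTorus (Fin 3) → EuclideanSpace ℝ (Fin 3)) (p : UnitAddTorus (Fin 3) → ℝ),
        Torus.IsClassicalNSSolutionOn Set.univ ν (fun _ => gpForce) (fun _ => u) (fun _ => p) →
        Torus.HasZeroMean u → IsGPSymmetric u →
        ∫ x, ‖Torus.fourierTruncate 1 u x‖ ^ 2 ≤
          C * ((∫ x, ‖u x‖ ^ 2) - (∫ x, ‖Torus.fourierTruncate 1 u x‖ ^ 2) + ν ^ 2) := by
  intro hpin hlamb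
  have hfs : Torus.IsSmooth gpForce := gpForce_smooth_divFree.1
  obtain ⟨K₁, K₂, K₄, -, hK₂, -, hbd⟩ := exists_bounds
  -- the definite coefficient `A = 3π/2` and the viscous weight `M = 8π²`
  set A : ℝ := 2 * Real.pi * (3 / 4) with hA_def
  set M : ℝ := 8 * Real.pi ^ 2 with hM_def
  have hA : 0 < A := by positivity
  have hM : 0 ≤ M := by positivity
  refine ⟨3 / (2 * A ^ 2) * (K₁ ^ 2 + A * (2 * K₂ + 1 + M ^ 2 * K₄ ^ 2)), by positivity,
    fun ν u p hsol hu0 hsym => ?_⟩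
  have hus : Torus.IsSmooth u := hsol.smooth_velocity.isSmooth_slice (Set.mem_univ (0 : ℝ))
  have hud : Torus.IsDivFree u := hsol.divFree 0 (Set.mem_univ _)
  have hP := hpin u hus hud hu0 hsym
  have hS5 := hlamb ν u p hsol
  -- `β = (2/3)(f_GP, u)` and the remainder `w = u − β f_GP`
  obtain ⟨β, hβ⟩ : ∃ β : ℝ, (2 : ℝ) / 3 * ∫ x, ⟪gpForce x, u x⟫_ℝ = β := ⟨_, rfl⟩
  rw [hβ] at hP
  obtain ⟨w, hws, hu⟩ : ∃ w : UnitAddTorus (Fin 3) → EuclideanSpace ℝ (Fin 3),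
      Torus.IsSmooth w ∧ ∀ x, u x = β • gpForce x + w x :=
    ⟨fun x => u x - β • gpForce x, hus.sub (hfs.smul β),
      fun x => (add_sub_cancel (β • gpForce x) (u x)).symm⟩
  -- `∫‖P₁u‖² = (3/2)β²`
  have hE1 : ∫ x, ‖Torus.fourierTruncate 1 u x‖ ^ 2 = 3 / 2 * β ^ 2 := by
    simp_rw [hP, Pi.smul_apply, norm_smul, mul_pow, Real.norm_eq_abs, sq_abs]
    rw [integral_const_mul, GPMeanBoundedFamily.StubHeadCoefficients.integral_norm_sq_gpForce]
    ring
  -- `(f_GP, w) = (f_GP, u) − β ∫‖f_GP‖² = (3/2)β − (3/2)β = 0`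
  have horth : ∫ x, ⟪gpForce x, w x⟫_ℝ = 0 := by
    have hpt : ∀ x, ⟪gpForce x, w x⟫_ℝ = ⟪gpForce x, u x⟫_ℝ - β * ‖gpForce x‖ ^ 2 := fun x => by
      rw [hu x, inner_add_right, real_inner_smul_right, real_inner_self_eq_norm_sq]
      ring
    simp_rw [hpt]
    rw [integral_sub (hfs.inner hus).integrable (hfs.norm_sq.integrable.const_mul β),
      integral_const_mul, GPMeanBoundedFamily.StubHeadCoefficients.integral_norm_sq_gpForce]
    linarith
  -- the tail energy `E' = ∫‖w‖² = ∫‖u‖² − ∫‖P₁u‖²`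
  have hE : ∫ x, ‖u x‖ ^ 2 = 3 / 2 * β ^ 2 + ∫ x, ‖w x‖ ^ 2 := integral_norm_sq_decomp hws hu horth
  -- the expanded Lamb-mode test: `A β² = β L + Q − M ν P`
  rw [integral_inner_convect_decomp hws hu, integral_inner_lambMode_decomp hws hu,
    integral_inner_convect_gpForce_lambMode_gpForce] at hS5
  obtain ⟨hL, hQ, hPg⟩ := hbd w hws
  have hE'0 : 0 ≤ ∫ x, ‖w x‖ ^ 2 := integral_nonneg fun x => sq_nonneg _
  have hsE : Real.sqrt (∫ x, ‖w x‖ ^ 2) ^ 2 = ∫ x, ‖w x‖ ^ 2 := Real.sq_sqrt hE'0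
  rw [← hsE] at hQ
  have hid : A * β ^ 2 =
      β * ((∫ x, ⟪Torus.convect gpForce lambMode x, w x⟫_ℝ) +
          ∫ x, ⟪Torus.convect w lambMode x, gpForce x⟫_ℝ) +
        (∫ x, ⟪Torus.convect w lambMode x, w x⟫_ℝ) - M * ν * ∫ x, ⟪w x, lambMode x⟫_ℝ := by
    rw [hA_def, hM_def]
    linarith
  have key := key_ineq hA hM hK₂ hL hQ hPg hid
  rw [hsE] at key
  rw [hE1, hE]
  have hsimp : 3 / 2 * β ^ 2 + (∫ x, ‖w x‖ ^ 2) - 3 / 2 * β ^ 2 + ν ^ 2 =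
      (∫ x, ‖w x‖ ^ 2) + ν ^ 2 := by ring
  rw [hsimp]
  exact key

end Summit.AnomalousDissipation.AnomalousDissipation.Theorems.VirtualDissipation.LightSteadyStatesGP

end
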